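import Literature.MathematicalPhysics.QuantumFieldTheory.ConformalBootstrap3D.MeanFieldAllSpins
import Literature.MathematicalPhysics.QuantumFieldTheory.ConformalBootstrap3D.BlockExistenceLimitAB
import Mathlib.Tactic
import HarnessLib

/-!
# Non-vacuity of the FULL typed bootstrap axioms A1–A4: the decoupled generalised-free pair

Every certificate of the tree proves `BoxExcluded Q`: "no `σ–ε` datum satisfying `SatisfiesBootstrapAxioms`
(A1–A4 of `SigmaEpsilonSystem`) has `(Δ_σ, Δ_ε) ∈ Q`". Until this file no datum satisfying the full axiom set
had been exhibited in the tree — only the single-correlator projection `SatisfiesSigmaAxioms` was witnessed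
(`freeScalarData`, `gffData`). A statement `∀ D, Hyp D → …` is only as good as `Hyp` is consistent (the A3
sign erratum of 2026-08-19 shows the risk is real). This file closes the gap.

**The witness.** Two DECOUPLED generalised free fields `σ := φ` (dimension `p`) and `ε := χ` (dimension `q`):
`⟨φφφφ⟩`, `⟨χχχχ⟩` are the mean-field four-point functions, `⟨φχφχ⟩ ↦ u^s` and `⟨χφφχ⟩ ↦ u^s v^{-p}`
(`s = (p+q)/2`, in the stripped conventions of the `σ–ε` system), `⟨φφχχ⟩ ↦ 1` (identity only:
`λ_{σσ𝒪} λ_{εε𝒪} = 0` for every non-identity `𝒪`). As a `SigmaEpsilonData` (`gffPairData p q C`): even sector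
`[φφ]_{n,2m} ⊔ [χχ]_{n,2m}` (blocks `hrBlock`, coefficients `√(2P_{n,2m}(p))` resp. `√(2P_{n,2m}(q))` on their own
family and `0` on the other), odd sector `[φχ]_{n,ℓ}` of dimension `p+q+2n+ℓ` and EVERY spin `ℓ`, blocks
`gmm = hrBlockAB (p-q) (p-q)`, `gpm = hrBlockAB (-(p-q)) (p-q)` (the typed `g^{Δ_σε,Δ_σε}`, `g^{-Δ_σε,Δ_σε}` of A2,
`BlockExistenceAB`), coefficients `√(C_{n,ℓ})`.

**The assembly theorem** `gffPairData_satisfiesBootstrapAxioms`: for `p, q > 1/2`, a non-negative odd-sector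
family `C` and the two mixed decompositions as `HasSum` identities on the open square —
(I) `Σ_{n,ℓ} (-1)^ℓ C_{n,ℓ} g^{(p-q),(p-q)}_{p+q+2n+ℓ,ℓ} = u^s` and (II) `Σ_{n,ℓ} C_{n,ℓ} g^{-(p-q),(p-q)}_{p+q+2n+ℓ,ℓ} = u^s v^{-p}`
— the datum satisfies A2 (every block typed: `IsAdmissible3D.isConformalBlock3D_hrBlock`,
`isConformalBlock3D_hrBlockAB_of_lt`, accidental points included), A1 (bounds, even spins, the three convergence
clauses), A3 (all FIVE sum rules: 1–2 are `hasSum_gff_crossing` at `p` and `q`; 3 is (I) at `(z,z̄)` and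
`(1-z,1-z̄)`: `v^s u^s - u^s v^s = 0`; 4–5 have vanishing even sums and odd sums `u^s ∓ v^s` from (II), against the
identity `v^s ∓ u^s`), and A4 exactly when `p + q ≥ 3`, `2q ≥ 3` and (`2p ≥ 3` or `q = 2p`) (the scalars are
`2p+2n`, `2q+2n`, `p+q+2n`).

**The unconditional instance** (this file): `q = p`, `C = P_{n,ℓ}(p)` (`mftCoeff`), where (I) and (II) are the
theorems `hasSum_mft_blocks_u`, `hasSum_mft_blocks_uv` of `MeanFieldAllSpins` (Fitzpatrick–Kaplan 2012 §2.2 at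
`Δ₁ = Δ₂`, proved in the tree by the Casimir-pair method) and `hrBlockAB 0 0 = hrBlock`:
`decoupledPairData_satisfiesBootstrapAxioms : 3/2 ≤ p → (decoupledPairData p).SatisfiesBootstrapAxioms`.
Consequences: `exists_satisfiesBootstrapAxioms` (**the typed axiom class A1–A4 is non-empty**, with a member at
every diagonal point `(Δ_σ, Δ_ε) = (p, p)`, `p ≥ 3/2`), `BoxExcluded.diag_not_mem` (no certificate of ANY shape
over these axioms excludes a box meeting the diagonal ray `{(p,p) : p ≥ 3/2}`), `IsingEnclosure.diag_mem`. The
general `(p, q)` instance (the whole quadrant `p, q ≥ 3/2` and the segment `(p, 2p)`, `p ≥ 1`) needs the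
unequal-dimension mean-field decompositions and is served by the same assembly theorem.

Decoupled generalised free fields are unitary CFT data in every `d` (Heemskerk–Penedones–Polchinski–Sully 2009
§2; Fitzpatrick–Kaplan 2012 §2.2); that they lie in the "bulk" allowed region of the mixed-correlator numerics
is Kos–Poland–Simmons-Duffin 2014 §5.3. Nothing here is a statement about the 3D Ising CFT.

References: A. L. Fitzpatrick, J. Kaplan, JHEP 10 (2012) 032, §2.2 [cite: FitzpatrickKaplan2012, §2.2];
I. Heemskerk, J. Penedones, J. Polchinski, J. Sully, JHEP 10 (2009) 079, §2 [cite: HeemskerkPenedonesPolchinskiSully2009, §2];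
F. Kos, D. Poland, D. Simmons-Duffin, JHEP 11 (2014) 109, §3.2 eqs. (3.10)–(3.13), §5.3
[cite: KosPolandSimmonsduffin2014, §3.2 eqs. (3.10)–(3.13)].
-/

namespace Literature.MathematicalPhysics.QuantumFieldTheory.ConformalBootstrap3D

open Set

/-! ### 1. The decoupled pair as a `σ–ε` datum -/

/-- **Two decoupled generalised free fields as a `σ–ε` datum**: `σ = φ` (`Δ_σ = p`), `ε = χ` (`Δ_ε = q`). Even
sector `ιp = (ℕ × ℕ) ⊕ (ℕ × ℕ)`: `inl (n,m)` ↦ `[φφ]_{n,2m}` (`Δ = 2p+2n+2m`, `ℓ = 2m`, `λ_{σσ} = √(2P_{n,2m}(p))`,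
`λ_{εε} = 0`), `inr (n,m)` ↦ `[χχ]_{n,2m}` (`Δ = 2q+2n+2m`, `λ_{σσ} = 0`, `λ_{εε} = √(2P_{n,2m}(q))`), blocks `hrBlock`;
odd sector `ιm = ℕ × ℕ`: `(n,ℓ)` ↦ `[φχ]_{n,ℓ}` (`Δ = p+q+2n+ℓ`, spin `ℓ`, `λ_{σε} = √(C_{n,ℓ})`), blocks
`gmm = g^{(p-q),(p-q)} = hrBlockAB (p-q) (p-q)`, `gpm = g^{-(p-q),(p-q)} = hrBlockAB (-(p-q)) (p-q)`. The odd-sector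
squared coefficients `C` are a parameter (the mean-field coefficients of Fitzpatrick–Kaplan 2012 §2.2 at
`(Δ₁, Δ₂) = (p, q)`; at `q = p`, `C = mftCoeff p`). [cite: FitzpatrickKaplan2012, §2.2] -/
noncomputable def gffPairData (p q : ℝ) (C : ℕ × ℕ → ℝ) : SigmaEpsilonData where
  Δσ := p
  Δε := q
  ιp := (ℕ × ℕ) ⊕ (ℕ × ℕ)
  Δp := Sum.elim (fun nm : ℕ × ℕ => 2 * p + 2 * nm.1 + 2 * nm.2) (fun nm => 2 * q + 2 * nm.1 + 2 * nm.2)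
  ℓp := Sum.elim (fun nm : ℕ × ℕ => 2 * nm.2) (fun nm => 2 * nm.2)
  lamσσ := Sum.elim (fun nm : ℕ × ℕ => Real.sqrt (gffOPECoeffSq p nm)) (fun _ => 0)
  lamεε := Sum.elim (fun _ : ℕ × ℕ => (0 : ℝ)) (fun nm => Real.sqrt (gffOPECoeffSq q nm))
  gp := Sum.elim (fun nm : ℕ × ℕ => hrBlock (2 * p + 2 * nm.1 + 2 * nm.2) (2 * nm.2))
    (fun nm => hrBlock (2 * q + 2 * nm.1 + 2 * nm.2) (2 * nm.2))
  ιm := ℕ × ℕ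
  Δm := fun nl => p + q + 2 * nl.1 + nl.2
  ℓm := fun nl => nl.2
  lamσε := fun nl => Real.sqrt (C nl)
  gmm := fun nl => hrBlockAB (p - q) (p - q) (p + q + 2 * nl.1 + nl.2) nl.2
  gpm := fun nl => hrBlockAB (-(p - q)) (p - q) (p + q + 2 * nl.1 + nl.2) nl.2

section unfolding

variable (p q : ℝ) (C : ℕ × ℕ → ℝ)

/-- Unfolding: `Δ_σ = p`. [folklore] -/
@[simp] theorem gffPairData_Δσ : (gffPairData p q C).Δσ = p := rfl

/-- Unfolding: `Δ_ε = q`. [folklore] -/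
@[simp] theorem gffPairData_Δε : (gffPairData p q C).Δε = q := rfl

/-- Unfolding: `Δ_σε = p - q`. [folklore] -/
@[simp] theorem gffPairData_Δσε : (gffPairData p q C).Δσε = p - q := rfl

/-- Unfolding (`[φφ]` family). [folklore] -/
@[simp] theorem gffPairData_Δp_inl (nm : ℕ × ℕ) :
    (gffPairData p q C).Δp (Sum.inl nm) = 2 * p + 2 * nm.1 + 2 * nm.2 := rfl

/-- Unfolding (`[χχ]` family). [folklore] -/
@[simp] theorem gffPairData_Δp_inr (nm : ℕ × ℕ) :
    (gffPairData p q C).Δp (Sum.inr nm) = 2 * q + 2 * nm.1 + 2 * nm.2 := rfl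

/-- Unfolding. [folklore] -/
@[simp] theorem gffPairData_ℓp_inl (nm : ℕ × ℕ) : (gffPairData p q C).ℓp (Sum.inl nm) = 2 * nm.2 := rfl

/-- Unfolding. [folklore] -/
@[simp] theorem gffPairData_ℓp_inr (nm : ℕ × ℕ) : (gffPairData p q C).ℓp (Sum.inr nm) = 2 * nm.2 := rfl

/-- Unfolding. [folklore] -/
@[simp] theorem gffPairData_lamσσ_inl (nm : ℕ × ℕ) :
    (gffPairData p q C).lamσσ (Sum.inl nm) = Real.sqrt (gffOPECoeffSq p nm) := rfl

/-- Unfolding. [folklore] -/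
@[simp] theorem gffPairData_lamσσ_inr (nm : ℕ × ℕ) : (gffPairData p q C).lamσσ (Sum.inr nm) = 0 := rfl

/-- Unfolding. [folklore] -/
@[simp] theorem gffPairData_lamεε_inl (nm : ℕ × ℕ) : (gffPairData p q C).lamεε (Sum.inl nm) = 0 := rfl

/-- Unfolding. [folklore] -/
@[simp] theorem gffPairData_lamεε_inr (nm : ℕ × ℕ) :
    (gffPairData p q C).lamεε (Sum.inr nm) = Real.sqrt (gffOPECoeffSq q nm) := rfl

/-- Unfolding. [folklore] -/
@[simp] theorem gffPairData_gp_inl (nm : ℕ × ℕ) :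
    (gffPairData p q C).gp (Sum.inl nm) = hrBlock (2 * p + 2 * nm.1 + 2 * nm.2) (2 * nm.2) := rfl

/-- Unfolding. [folklore] -/
@[simp] theorem gffPairData_gp_inr (nm : ℕ × ℕ) :
    (gffPairData p q C).gp (Sum.inr nm) = hrBlock (2 * q + 2 * nm.1 + 2 * nm.2) (2 * nm.2) := rfl

/-- Unfolding. [folklore] -/
@[simp] theorem gffPairData_Δm (nl : ℕ × ℕ) : (gffPairData p q C).Δm nl = p + q + 2 * nl.1 + nl.2 := rfl

/-- Unfolding. [folklore] -/
@[simp] theorem gffPairData_ℓm (nl : ℕ × ℕ) : (gffPairData p q C).ℓm nl = nl.2 := rfl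

/-- Unfolding. [folklore] -/
@[simp] theorem gffPairData_lamσε (nl : ℕ × ℕ) : (gffPairData p q C).lamσε nl = Real.sqrt (C nl) := rfl

/-- Unfolding. [folklore] -/
@[simp] theorem gffPairData_gmm (nl : ℕ × ℕ) :
    (gffPairData p q C).gmm nl = hrBlockAB (p - q) (p - q) (p + q + 2 * nl.1 + nl.2) nl.2 := rfl

/-- Unfolding. [folklore] -/
@[simp] theorem gffPairData_gpm (nl : ℕ × ℕ) :
    (gffPairData p q C).gpm nl = hrBlockAB (-(p - q)) (p - q) (p + q + 2 * nl.1 + nl.2) nl.2 := rfl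

end unfolding

/-- The odd-sector double-twist points `(p+q+2n+ℓ, ℓ)` are strictly above the unitarity bound for
`p, q > 1/2`. [folklore] -/
theorem pair_unitarity {p q : ℝ} (hp : 1 / 2 < p) (hq : 1 / 2 < q) (n ℓ : ℕ) :
    unitarityBound3D ℓ < p + q + 2 * (n : ℝ) + (ℓ : ℝ) := by
  have h := unitarityBound3D_lt_twist (p := (p + q) / 2) (by linarith) n ℓ
  have e : 2 * ((p + q) / 2) + 2 * (n : ℝ) + (ℓ : ℝ) = p + q + 2 * (n : ℝ) + (ℓ : ℝ) := by ring
  rwa [e] at h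

/-! ### 2. A2 and A1 -/

/-- **A2 for the decoupled pair**: every block function is a typed block — even sector by
`IsAdmissible3D.isConformalBlock3D_hrBlock`, odd sector (all spins, both orderings, accidental points included)
by `isConformalBlock3D_hrBlockAB_of_lt`. [cite: KosPolandSimmonsduffin2014, §3.1 eq. (3.4)] -/
theorem gffPairData_hasGenuineBlocks {p q : ℝ} (hp : 1 / 2 < p) (hq : 1 / 2 < q) (C : ℕ × ℕ → ℝ) :
    (gffPairData p q C).HasGenuineBlocks := by
  refine ⟨?_, ?_, ?_⟩
  · rintro (nm | nm)
    · exact (isAdmissible3D_of_lt (gff_unitarity hp nm.1 nm.2)).isConformalBlock3D_hrBlock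
    · exact (isAdmissible3D_of_lt (gff_unitarity hq nm.1 nm.2)).isConformalBlock3D_hrBlock
  · intro nl
    exact isConformalBlock3D_hrBlockAB_of_lt _ _ (pair_unitarity hp hq nl.1 nl.2)
  · intro nl
    exact isConformalBlock3D_hrBlockAB_of_lt _ _ (pair_unitarity hp hq nl.1 nl.2)

/-- **A1 (spectral part) for the decoupled pair**: `p, q ≥ 1/2`, unitarity bounds in both sectors, even spins
in the even sector. [cite: KosPolandSimmonsduffin2014, §3.2–3.3] -/
theorem gffPairData_satisfiesUnitarity {p q : ℝ} (hp : 1 / 2 < p) (hq : 1 / 2 < q) (C : ℕ × ℕ → ℝ) :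
    (gffPairData p q C).SatisfiesUnitarity := by
  refine ⟨?_, ?_, ?_, ?_, ?_⟩
  · change 1 / 2 ≤ p; exact hp.le
  · change 1 / 2 ≤ q; exact hq.le
  · rintro (nm | nm)
    · exact (gff_unitarity hp nm.1 nm.2).le
    · exact (gff_unitarity hq nm.1 nm.2).le
  · rintro (nm | nm)
    · change Even (2 * nm.2); exact even_two_mul _
    · change Even (2 * nm.2); exact even_two_mul _
  · intro nl
    exact (pair_unitarity hp hq nl.1 nl.2).le

/-- **A1 (convergence clauses) for the decoupled pair**: the diagonal sums `Σ λ²_{σσ} g(x,x)`, `Σ λ²_{εε} g(x,x)`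
converge by `hasSum_gff_blocks` (the other family contributing zeros), and `Σ λ²_{σε} g^{-Δ_σε,Δ_σε}(x,x)` by the
mixed decomposition (II). [cite: PappadopuloRychkovEspinRattazzi2012, §4.1] -/
theorem gffPairData_hasConvergentWeights {p q : ℝ} (hp : 1 / 2 < p) (hq : 1 / 2 < q) {C : ℕ × ℕ → ℝ}
    (hC : ∀ nl, 0 ≤ C nl)
    (hII : ∀ z zb : ℝ, z ∈ Ioo (0 : ℝ) 1 → zb ∈ Ioo (0 : ℝ) 1 →
      HasSum (fun nl : ℕ × ℕ => C nl * hrBlockAB (-(p - q)) (p - q) (p + q + 2 * nl.1 + nl.2) nl.2 z zb)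
        ((z * zb) ^ ((p + q) / 2) / ((1 - z) * (1 - zb)) ^ p)) :
    (gffPairData p q C).HasConvergentWeights := by
  intro x hx0 hx1
  refine ⟨?_, ?_, ?_⟩
  · refine Summable.sum _ ?_ ?_
    · refine (summable_gff_blocks_diag hp hx0 hx1).congr fun nm => ?_
      simp only [Function.comp_apply, gffPairData_lamσσ_inl, gffPairData_gp_inl,
        Real.sq_sqrt (gffOPECoeffSq_pos hp _).le]
    · refine (summable_zero (α := ℝ) (β := ℕ × ℕ)).congr fun nm => ?_
      simp only [Function.comp_apply, gffPairData_lamσσ_inr]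
      ring
  · refine Summable.sum _ ?_ ?_
    · refine (summable_zero (α := ℝ) (β := ℕ × ℕ)).congr fun nm => ?_
      simp only [Function.comp_apply, gffPairData_lamεε_inl]
      ring
    · refine (summable_gff_blocks_diag hq hx0 hx1).congr fun nm => ?_
      simp only [Function.comp_apply, gffPairData_lamεε_inr, gffPairData_gp_inr,
        Real.sq_sqrt (gffOPECoeffSq_pos hq _).le]
  · have e : (fun j => (gffPairData p q C).lamσε j ^ 2 * (gffPairData p q C).gpm j x x) =
        fun nl : ℕ × ℕ => C nl * hrBlockAB (-(p - q)) (p - q) (p + q + 2 * nl.1 + nl.2) nl.2 x x := by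
      funext nl
      simp only [gffPairData_lamσε, gffPairData_gpm, Real.sq_sqrt (hC nl)]
    rw [e]
    exact (hII x x ⟨hx0, hx1⟩ ⟨hx0, hx1⟩).summable

/-! ### 3. A3: the five sum rules -/

/-- **A3 for the decoupled pair — all five sum rules.** Rules 1–2: `hasSum_gff_crossing` at `p` and at `q` (the
other family contributes zeros). Rule 3: from (I) at `(z,z̄)` and `(1-z,1-z̄)`, `v^s·u^s - u^s·v^s = 0`. Rules 4–5:
the even sums vanish termwise (`λ_{σσ𝒪} λ_{εε𝒪} = 0`), and from (II) the odd sums are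
`v^p (u^s v^{-p}) ∓ u^p (v^s u^{-p}) = u^s ∓ v^s`, cancelling the identity `v^s ∓ u^s`.
[cite: KosPolandSimmonsduffin2014, §3.2 eqs. (3.10)–(3.13)] -/
theorem gffPairData_satisfiesCrossing {p q : ℝ} (hp : 1 / 2 < p) (hq : 1 / 2 < q) {C : ℕ × ℕ → ℝ}
    (hC : ∀ nl, 0 ≤ C nl)
    (hI : ∀ z zb : ℝ, z ∈ Ioo (0 : ℝ) 1 → zb ∈ Ioo (0 : ℝ) 1 →
      HasSum (fun nl : ℕ × ℕ => (-1 : ℝ) ^ nl.2 * C nl *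
          hrBlockAB (p - q) (p - q) (p + q + 2 * nl.1 + nl.2) nl.2 z zb) ((z * zb) ^ ((p + q) / 2)))
    (hII : ∀ z zb : ℝ, z ∈ Ioo (0 : ℝ) 1 → zb ∈ Ioo (0 : ℝ) 1 →
      HasSum (fun nl : ℕ × ℕ => C nl * hrBlockAB (-(p - q)) (p - q) (p + q + 2 * nl.1 + nl.2) nl.2 z zb)
        ((z * zb) ^ ((p + q) / 2) / ((1 - z) * (1 - zb)) ^ p)) :
    (gffPairData p q C).SatisfiesCrossing := by
  intro z zb hz hzb
  have hz' : 1 - z ∈ Ioo (0 : ℝ) 1 := ⟨by linarith [hz.2], by linarith [hz.1]⟩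
  have hzb' : 1 - zb ∈ Ioo (0 : ℝ) 1 := ⟨by linarith [hzb.2], by linarith [hzb.1]⟩
  set s : ℝ := (p + q) / 2 with hs
  have hu : 0 < z * zb := mul_pos hz.1 hzb.1
  have hv : 0 < (1 - z) * (1 - zb) := mul_pos hz'.1 hzb'.1
  have hus : 0 < (z * zb) ^ s := Real.rpow_pos_of_pos hu _
  have hvs : 0 < ((1 - z) * (1 - zb)) ^ s := Real.rpow_pos_of_pos hv _
  have hup : 0 < (z * zb) ^ p := Real.rpow_pos_of_pos hu _
  have hvp : 0 < ((1 - z) * (1 - zb)) ^ p := Real.rpow_pos_of_pos hv _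
  have hΔs : ((gffPairData p q C).Δσ + (gffPairData p q C).Δε) / 2 = s := rfl
  refine ⟨?_, ?_, ?_, ?_, ?_⟩
  · -- rule 1: `⟨σσσσ⟩`
    have h1 : HasSum ((fun i => (gffPairData p q C).lamσσ i ^ 2 *
        crossF (gffPairData p q C).Δσ (-1) ((gffPairData p q C).gp i) z zb) ∘ Sum.inl)
        (-(crossF p (-1) (fun _ _ => (1 : ℝ)) z zb)) := by
      refine (hasSum_gff_crossing hp hz hzb).congr_fun fun nm => ?_
      simp only [Function.comp_apply, gffPairData_lamσσ_inl, gffPairData_gp_inl, gffPairData_Δσ,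
        Real.sq_sqrt (gffOPECoeffSq_pos hp _).le]
    have h2 : HasSum ((fun i => (gffPairData p q C).lamσσ i ^ 2 *
        crossF (gffPairData p q C).Δσ (-1) ((gffPairData p q C).gp i) z zb) ∘ Sum.inr) 0 := by
      refine (hasSum_zero (α := ℝ) (β := ℕ × ℕ)).congr_fun fun nm => ?_
      simp only [Function.comp_apply, gffPairData_lamσσ_inr]
      ring
    have h := h1.sum h2
    rw [add_zero] at h
    exact h
  · -- rule 2: `⟨εεεε⟩`
    have h1 : HasSum ((fun i => (gffPairData p q C).lamεε i ^ 2 *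
        crossF (gffPairData p q C).Δε (-1) ((gffPairData p q C).gp i) z zb) ∘ Sum.inl) 0 := by
      refine (hasSum_zero (α := ℝ) (β := ℕ × ℕ)).congr_fun fun nm => ?_
      simp only [Function.comp_apply, gffPairData_lamεε_inl]
      ring
    have h2 : HasSum ((fun i => (gffPairData p q C).lamεε i ^ 2 *
        crossF (gffPairData p q C).Δε (-1) ((gffPairData p q C).gp i) z zb) ∘ Sum.inr)
        (-(crossF q (-1) (fun _ _ => (1 : ℝ)) z zb)) := by
      refine (hasSum_gff_crossing hq hz hzb).congr_fun fun nm => ?_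
      simp only [Function.comp_apply, gffPairData_lamεε_inr, gffPairData_gp_inr, gffPairData_Δε,
        Real.sq_sqrt (gffOPECoeffSq_pos hq _).le]
    have h := h1.sum h2
    rw [zero_add] at h
    exact h
  · -- rule 3: `⟨σεσε⟩`, the `(-1)^ℓ` family, no identity
    rw [hΔs]
    have hA := (hI z zb hz hzb).mul_left (((1 - z) * (1 - zb)) ^ s)
    have hB := ((hI (1 - z) (1 - zb) hz' hzb').mul_left ((z * zb) ^ s)).mul_left (-1)
    have h := hA.add hB
    have e : (fun j => (-1 : ℝ) ^ (gffPairData p q C).ℓm j * (gffPairData p q C).lamσε j ^ 2 *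
        crossF s (-1) ((gffPairData p q C).gmm j) z zb) =
        fun nl : ℕ × ℕ => ((1 - z) * (1 - zb)) ^ s * ((-1 : ℝ) ^ nl.2 * C nl *
            hrBlockAB (p - q) (p - q) (p + q + 2 * nl.1 + nl.2) nl.2 z zb) +
          -1 * ((z * zb) ^ s * ((-1 : ℝ) ^ nl.2 * C nl *
            hrBlockAB (p - q) (p - q) (p + q + 2 * nl.1 + nl.2) nl.2 (1 - z) (1 - zb))) := by
      funext nl
      simp only [gffPairData_ℓm, gffPairData_lamσε, gffPairData_gmm, Real.sq_sqrt (hC nl), crossF]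
      ring
    have hval : (0 : ℝ) = ((1 - z) * (1 - zb)) ^ s * (z * zb) ^ s + -1 * ((z * zb) ^ s * ((1 - z) * (1 - zb)) ^ s) := by
      ring
    rw [e, hval]
    exact h
  · -- rule 4: `F_-`, even sum `0`, odd sum `u^s - v^s`
    refine ⟨0, (z * zb) ^ s - ((1 - z) * (1 - zb)) ^ s, ?_, ?_, ?_⟩
    · have e : (fun i => (gffPairData p q C).lamσσ i * (gffPairData p q C).lamεε i *
          crossF (((gffPairData p q C).Δσ + (gffPairData p q C).Δε) / 2) (-1) ((gffPairData p q C).gp i) z zb) =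
          fun _ => 0 := by
        funext i
        rcases i with nm | nm
        · simp only [gffPairData_lamεε_inl]; ring
        · simp only [gffPairData_lamσσ_inr]; ring
      rw [e]
      exact hasSum_zero
    · have hA := (hII z zb hz hzb).mul_left (((1 - z) * (1 - zb)) ^ p)
      have hB := ((hII (1 - z) (1 - zb) hz' hzb').mul_left ((z * zb) ^ p)).mul_left (-1)
      have h := hA.add hB
      rw [sub_sub_cancel, sub_sub_cancel] at h
      have e : (fun j => (gffPairData p q C).lamσε j ^ 2 *
          crossF (gffPairData p q C).Δσ (-1) ((gffPairData p q C).gpm j) z zb) =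
          fun nl : ℕ × ℕ => ((1 - z) * (1 - zb)) ^ p * (C nl *
              hrBlockAB (-(p - q)) (p - q) (p + q + 2 * nl.1 + nl.2) nl.2 z zb) +
            -1 * ((z * zb) ^ p * (C nl *
              hrBlockAB (-(p - q)) (p - q) (p + q + 2 * nl.1 + nl.2) nl.2 (1 - z) (1 - zb))) := by
        funext nl
        simp only [gffPairData_lamσε, gffPairData_gpm, gffPairData_Δσ, Real.sq_sqrt (hC nl), crossF]
        ring
      have hval : (z * zb) ^ s - ((1 - z) * (1 - zb)) ^ s =
          ((1 - z) * (1 - zb)) ^ p * ((z * zb) ^ s / ((1 - z) * (1 - zb)) ^ p) +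
            -1 * ((z * zb) ^ p * (((1 - z) * (1 - zb)) ^ s / (z * zb) ^ p)) := by
        rw [mul_div_cancel₀ _ hvp.ne', mul_div_cancel₀ _ hup.ne']
        ring
      rw [e, hval]
      exact h
    · rw [hΔs]
      unfold crossF
      ring
  · -- rule 5: `F_+`, even sum `0`, odd sum `u^s + v^s`
    refine ⟨0, (z * zb) ^ s + ((1 - z) * (1 - zb)) ^ s, ?_, ?_, ?_⟩
    · have e : (fun i => (gffPairData p q C).lamσσ i * (gffPairData p q C).lamεε i *
          crossF (((gffPairData p q C).Δσ + (gffPairData p q C).Δε) / 2) 1 ((gffPairData p q C).gp i) z zb) =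
          fun _ => 0 := by
        funext i
        rcases i with nm | nm
        · simp only [gffPairData_lamεε_inl]; ring
        · simp only [gffPairData_lamσσ_inr]; ring
      rw [e]
      exact hasSum_zero
    · have hA := (hII z zb hz hzb).mul_left (((1 - z) * (1 - zb)) ^ p)
      have hB := (hII (1 - z) (1 - zb) hz' hzb').mul_left ((z * zb) ^ p)
      have h := hA.add hB
      rw [sub_sub_cancel, sub_sub_cancel] at h
      have e : (fun j => (gffPairData p q C).lamσε j ^ 2 *
          crossF (gffPairData p q C).Δσ 1 ((gffPairData p q C).gpm j) z zb) =
          fun nl : ℕ × ℕ => ((1 - z) * (1 - zb)) ^ p * (C nl *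
              hrBlockAB (-(p - q)) (p - q) (p + q + 2 * nl.1 + nl.2) nl.2 z zb) +
            (z * zb) ^ p * (C nl *
              hrBlockAB (-(p - q)) (p - q) (p + q + 2 * nl.1 + nl.2) nl.2 (1 - z) (1 - zb)) := by
        funext nl
        simp only [gffPairData_lamσε, gffPairData_gpm, gffPairData_Δσ, Real.sq_sqrt (hC nl), crossF]
        ring
      have hval : (z * zb) ^ s + ((1 - z) * (1 - zb)) ^ s =
          ((1 - z) * (1 - zb)) ^ p * ((z * zb) ^ s / ((1 - z) * (1 - zb)) ^ p) +
            (z * zb) ^ p * (((1 - z) * (1 - zb)) ^ s / (z * zb) ^ p) := by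
        rw [mul_div_cancel₀ _ hvp.ne', mul_div_cancel₀ _ hup.ne']
      rw [e, hval]
      exact h
    · rw [hΔs]
      unfold crossF
      ring

/-! ### 4. A4 -/

/-- **A4 for the decoupled pair.** The scalars are `[φφ]_{n,0}` at `2p+2n`, `[χχ]_{n,0}` at `2q+2n` and
`[φχ]_{n,0}` at `p+q+2n`; the gaps "odd scalars below `3` are `σ`, even scalars below `3` are `ε`" hold iff
`p+q ≥ 3`, `2q ≥ 3`, and `2p ≥ 3` or `2p = q` (then `[φφ]_{0,0}` sits exactly at `Δ_ε` and `[φφ]_{n,0}`, `n ≥ 1`,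
above `2p + 2 > 3`). [cite: KosPolandSimmonsduffin2014, §5.3] -/
theorem gffPairData_onlySigmaEpsilonRelevant {p q : ℝ} (hp : 1 / 2 < p) (h3 : 3 ≤ p + q) (hε : 3 ≤ 2 * q)
    (hσ : 3 ≤ 2 * p ∨ 2 * p = q) (C : ℕ × ℕ → ℝ) : (gffPairData p q C).OnlySigmaEpsilonRelevant := by
  refine ⟨?_, ?_⟩
  · intro nl h0 hlt
    exfalso
    simp only [gffPairData_ℓm] at h0
    simp only [gffPairData_Δm, h0, Nat.cast_zero, add_zero] at hlt
    have hn : (0 : ℝ) ≤ nl.1 := Nat.cast_nonneg _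
    linarith
  · rintro (nm | nm) h0 hlt
    · simp only [gffPairData_ℓp_inl] at h0
      have hm : nm.2 = 0 := by omega
      simp only [gffPairData_Δp_inl, hm, Nat.cast_zero, mul_zero, add_zero] at hlt
      change 2 * p + 2 * (nm.1 : ℝ) + 2 * (nm.2 : ℝ) = q
      rw [hm, Nat.cast_zero, mul_zero, add_zero]
      rcases hσ with hσ | hσ
      · exfalso
        have hn : (0 : ℝ) ≤ nm.1 := Nat.cast_nonneg _
        linarith
      · rcases Nat.eq_zero_or_pos nm.1 with hn | hn
        · rw [hn, Nat.cast_zero, mul_zero, add_zero, hσ]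
        · exfalso
          have hn1 : (1 : ℝ) ≤ nm.1 := by exact_mod_cast hn
          linarith
    · simp only [gffPairData_ℓp_inr] at h0
      have hm : nm.2 = 0 := by omega
      simp only [gffPairData_Δp_inr, hm, Nat.cast_zero, mul_zero, add_zero] at hlt
      exfalso
      have hn : (0 : ℝ) ≤ nm.1 := Nat.cast_nonneg _
      linarith

/-! ### 5. The assembly theorem -/

/-- **The decoupled generalised-free pair satisfies the full typed axioms A1–A4**, given the two mixed
mean-field decompositions (I) `Σ (-1)^ℓ C_{n,ℓ} g^{(p-q),(p-q)}_{p+q+2n+ℓ,ℓ} = u^s` and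
(II) `Σ C_{n,ℓ} g^{-(p-q),(p-q)}_{p+q+2n+ℓ,ℓ} = u^s v^{-p}` with `C ≥ 0`, for `p, q > 1/2` in the A4 range
`p + q ≥ 3`, `2q ≥ 3`, `2p ≥ 3 ∨ 2p = q`. [cite: KosPolandSimmonsDuffinVichi2016, §2.1] -/
theorem gffPairData_satisfiesBootstrapAxioms {p q : ℝ} (hp : 1 / 2 < p) (hq : 1 / 2 < q) (h3 : 3 ≤ p + q)
    (hε : 3 ≤ 2 * q) (hσ : 3 ≤ 2 * p ∨ 2 * p = q) {C : ℕ × ℕ → ℝ} (hC : ∀ nl, 0 ≤ C nl)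
    (hI : ∀ z zb : ℝ, z ∈ Ioo (0 : ℝ) 1 → zb ∈ Ioo (0 : ℝ) 1 →
      HasSum (fun nl : ℕ × ℕ => (-1 : ℝ) ^ nl.2 * C nl *
          hrBlockAB (p - q) (p - q) (p + q + 2 * nl.1 + nl.2) nl.2 z zb) ((z * zb) ^ ((p + q) / 2)))
    (hII : ∀ z zb : ℝ, z ∈ Ioo (0 : ℝ) 1 → zb ∈ Ioo (0 : ℝ) 1 →
      HasSum (fun nl : ℕ × ℕ => C nl * hrBlockAB (-(p - q)) (p - q) (p + q + 2 * nl.1 + nl.2) nl.2 z zb)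
        ((z * zb) ^ ((p + q) / 2) / ((1 - z) * (1 - zb)) ^ p)) :
    (gffPairData p q C).SatisfiesBootstrapAxioms :=
  ⟨gffPairData_hasGenuineBlocks hp hq C, gffPairData_satisfiesUnitarity hp hq C,
    gffPairData_hasConvergentWeights hp hq hC hII, gffPairData_satisfiesCrossing hp hq hC hI hII,
    gffPairData_onlySigmaEpsilonRelevant hp h3 hε hσ C⟩

/-! ### 6. The unconditional instance: equal dimensions -/

/-- **Two decoupled generalised free fields of the same dimension `p`** as a `σ–ε` datum, `(Δ_σ, Δ_ε) = (p, p)`: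
odd-sector coefficients `C_{n,ℓ} = P_{n,ℓ}(p)` (`mftCoeff`, Fitzpatrick–Kaplan 2012 §2.2 at `Δ₁ = Δ₂ = p`), odd
blocks `g^{0,0}`. [cite: FitzpatrickKaplan2012, §2.2] -/
noncomputable def decoupledPairData (p : ℝ) : SigmaEpsilonData :=
  gffPairData p p (fun nl => mftCoeff p nl.1 nl.2)

/-- Unfolding: `Δ_σ = p`. [folklore] -/
@[simp] theorem decoupledPairData_Δσ (p : ℝ) : (decoupledPairData p).Δσ = p := rfl

/-- Unfolding: `Δ_ε = p`. [folklore] -/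
@[simp] theorem decoupledPairData_Δε (p : ℝ) : (decoupledPairData p).Δε = p := rfl

/-- At equal dimensions the odd-sector blocks are the `g^{0,0}` blocks at `2p+2n+ℓ`. [folklore] -/
theorem hrBlockAB_pair_self (p : ℝ) (n ℓ : ℕ) :
    hrBlockAB (p - p) (p - p) (p + p + 2 * n + ℓ) ℓ = hrBlock (2 * p + 2 * n + ℓ) ℓ := by
  rw [sub_self, hrBlockAB_zero_zero, ← two_mul]

/-- The same for the `⟨εσσε⟩` ordering. [folklore] -/
theorem hrBlockAB_pair_self' (p : ℝ) (n ℓ : ℕ) :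
    hrBlockAB (-(p - p)) (p - p) (p + p + 2 * n + ℓ) ℓ = hrBlock (2 * p + 2 * n + ℓ) ℓ := by
  rw [sub_self, neg_zero, hrBlockAB_zero_zero, ← two_mul]

/-- **The decoupled pair of dimension `p ≥ 3/2` satisfies the FULL typed bootstrap axioms A1–A4** at
`(Δ_σ, Δ_ε) = (p, p)`: the mixed decompositions are `hasSum_mft_blocks_u` (`u^p = Σ (-1)^ℓ P_{n,ℓ} g`) and
`hasSum_mft_blocks_uv` (`(u/v)^p = Σ P_{n,ℓ} g`). [cite: FitzpatrickKaplan2012, §2.2] -/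
theorem decoupledPairData_satisfiesBootstrapAxioms {p : ℝ} (hp : 3 / 2 ≤ p) :
    (decoupledPairData p).SatisfiesBootstrapAxioms := by
  have hp' : 1 / 2 < p := by linarith
  refine gffPairData_satisfiesBootstrapAxioms hp' hp' (by linarith) (by linarith) (Or.inl (by linarith))
    (fun nl => mftCoeff_nonneg hp' nl.1 nl.2) ?_ ?_
  · intro z zb hz hzb
    have h := hasSum_mft_blocks_u hp' hz hzb
    have e : (fun nl : ℕ × ℕ => (-1 : ℝ) ^ nl.2 * mftCoeff p nl.1 nl.2 *
        hrBlockAB (p - p) (p - p) (p + p + 2 * nl.1 + nl.2) nl.2 z zb) =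
        fun m : ℕ × ℕ => (-1 : ℝ) ^ m.2 * mftCoeff p m.1 m.2 * hrBlock (2 * p + 2 * m.1 + m.2) m.2 z zb := by
      funext nl
      rw [hrBlockAB_pair_self]
    have ev : (z * zb) ^ ((p + p) / 2) = (z * zb) ^ p := by rw [← two_mul, mul_div_cancel_left₀ p two_ne_zero]
    rw [e, ev]
    exact h
  · intro z zb hz hzb
    have h := hasSum_mft_blocks_uv hp' hz hzb
    have e : (fun nl : ℕ × ℕ => mftCoeff p nl.1 nl.2 *
        hrBlockAB (-(p - p)) (p - p) (p + p + 2 * nl.1 + nl.2) nl.2 z zb) =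
        fun m : ℕ × ℕ => mftCoeff p m.1 m.2 * hrBlock (2 * p + 2 * m.1 + m.2) m.2 z zb := by
      funext nl
      rw [hrBlockAB_pair_self']
    have ev : (z * zb) ^ ((p + p) / 2) = (z * zb) ^ p := by rw [← two_mul, mul_div_cancel_left₀ p two_ne_zero]
    rw [e, ev]
    exact h

/-! ### 7. Consequences: the full axiom class is non-empty; the diagonal ray is never excluded -/

/-- **The typed bootstrap axioms A1–A4 are consistent**: for every `p ≥ 3/2` there is a datum satisfying
`SatisfiesBootstrapAxioms` with `(Δ_σ, Δ_ε) = (p, p)`. [cite: FitzpatrickKaplan2012, §2.2] -/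
theorem exists_satisfiesBootstrapAxioms {p : ℝ} (hp : 3 / 2 ≤ p) :
    ∃ D : SigmaEpsilonData, D.SatisfiesBootstrapAxioms ∧ D.Δσ = p ∧ D.Δε = p :=
  ⟨decoupledPairData p, decoupledPairData_satisfiesBootstrapAxioms hp, rfl, rfl⟩

/-- The hypothesis class of every certificate of the tree (`BoxExcluded`, `IsingEnclosure`) is non-empty.
[cite: FitzpatrickKaplan2012, §2.2] -/
theorem nonempty_satisfiesBootstrapAxioms : ∃ D : SigmaEpsilonData, D.SatisfiesBootstrapAxioms :=
  ⟨decoupledPairData 2, decoupledPairData_satisfiesBootstrapAxioms (by norm_num)⟩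

/-- **No excluded box contains a diagonal point `(p, p)`, `p ≥ 3/2`**: whatever its shape (point functional,
kernel certificate, mixed-correlator table), a certificate proving `BoxExcluded Q` over the typed axioms cannot
have `(p,p) ∈ Q` — the decoupled pair realises the axioms there (the bulk region of the mixed-correlator numerics,
Kos–Poland–Simmons-Duffin 2014 §5.3). [cite: KosPolandSimmonsduffin2014, §5.3] -/
theorem BoxExcluded.diag_not_mem {Q : Set (ℝ × ℝ)} (h : BoxExcluded Q) {p : ℝ} (hp : 3 / 2 ≤ p) :
    (p, p) ∉ Q :=
  h (decoupledPairData p) (decoupledPairData_satisfiesBootstrapAxioms hp)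

/-- Contrapositive form: a box containing a diagonal point `(p, p)`, `p ≥ 3/2`, is not excluded.
[cite: KosPolandSimmonsduffin2014, §5.3] -/
theorem not_boxExcluded_of_diag_mem {Q : Set (ℝ × ℝ)} {p : ℝ} (hp : 3 / 2 ≤ p) (hQ : (p, p) ∈ Q) :
    ¬ BoxExcluded Q :=
  fun h => h.diag_not_mem hp hQ

/-- **Sanity constraint on enclosures**: if the window of an `IsingEnclosure W R` contains a diagonal point
`(p, p)`, `p ≥ 3/2`, then so does the region. (The windows of the tree's enclosures, `Δ_σ ≤ 0.6`, do not.)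
[cite: KosPolandSimmonsduffin2014, §5.3] -/
theorem IsingEnclosure.diag_mem {W R : Set (ℝ × ℝ)} (h : IsingEnclosure W R) {p : ℝ} (hp : 3 / 2 ≤ p)
    (hW : (p, p) ∈ W) : (p, p) ∈ R :=
  h (decoupledPairData p) (decoupledPairData_satisfiesBootstrapAxioms hp) hW

/-- In particular an enclosure with EMPTY region has a window missing the whole diagonal ray
`{(p,p) : p ≥ 3/2}`. [cite: KosPolandSimmonsduffin2014, §5.3] -/
theorem IsingEnclosure.diag_not_mem_of_empty {W : Set (ℝ × ℝ)} (h : IsingEnclosure W ∅) {p : ℝ}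
    (hp : 3 / 2 ≤ p) : (p, p) ∉ W :=
  fun hW => h.diag_mem hp hW

end Literature.MathematicalPhysics.QuantumFieldTheory.ConformalBootstrap3D
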